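import Literature.Analysis.InnerProduct.HilbertComplexRolledUpFredholm
import HarnessLib

/-!
# The dual Hilbert complex `0 → G →S* F →T* E → 0` of a short complex `0 → E →T F →S G → 0`: it is Fredholm iff the
# complex is, with the same harmonic space, reversed Betti numbers and the same index (Brüning–Lesch 1992, Cor 2.6)

Layer `Literature/Analysis/InnerProduct`, namespace `Literature.Analysis.InnerProduct`; sequel BY NAME of
`HilbertComplexRolledUpFredholm.lean` (row g33-#10: `rolledUp_fredholm_iff`,
`finiteDimensional_cohomology_iff_rolledUp_fredholm`, `nonempty_pmapKer_adjoint_linearEquiv_quotient_range`),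
`HilbertComplexRolledUp.lean` (row g33-#8: `exists_rolledUp`, `finrank_pmapKer_rolledUp_sub_finrank_orthogonal_range`),
`HilbertComplexHarmonicCohomology.lean` (`nonempty_linearEquiv_harmonic_quotient_range`,
`nonempty_linearEquiv_harmonic_quotient_range_adjoint` — the middle-degree isomorphisms `𝔥 ≅ Ker S / Im T`,
`𝔥 ≅ Ker T* / Im S*`), `HilbertComplexFiniteCohomology.lean` (`isClosed_range_of_finiteDimensional_cohomology`,
`isClosed_range_of_finiteDimensional_quotient`), `ClosedRangeTheoremHilbert.lean`
(`isClosed_range_iff_isClosed_range_adjoint`, Kato IV Thm 5.13) and `ClosedDenselyDefinedHilbertComplex.lean`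
(`adjoint_adjoint_of_isClosed`, `dense_adjoint_domain_of_isClosed`, `range_adjoint_le_pmapKer_adjoint`). Lane
`lit-hodgefound` (Track 2 foundations library), prover seat `lit-hodgefound-p06` (generation 34), self-proposed row
g34-#2. THEOREMS ONLY (no definition, no instance, no named fact). Unbounded operators are Mathlib's `LinearPMap`
(`T : E →ₗ.[𝕜] F`, adjoint `T†`, `T.IsClosed`); the kernel of `T` as a subspace of the source is
`(LinearMap.ker T.toFun).map T.domain.subtype` (`mem_pmapKer_iff`).

## Source, verbatim

J. Brüning, M. Lesch, *Hilbert complexes*, J. Funct. Anal. 108 (1992), §2 pp. 90–91, 94–96 (held text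
`paper:doi-10-1016-0022-1236-92-90147-b`, p0003–p0004, p0007–p0009):

"For each Hilbert complex `(𝒟, D)` we can introduce a dual complex, `(𝒟*, D*)`, as follows. It is immediate from
(2.1) that the adjoint operators satisfy `D*_{i−1}(𝒟*_i) ⊂ 𝒟*_{i−1}` (2.5a) and `D*_{i−1} ∘ D*_i = 0` (2.5b) so
`(𝒟*, D*)` is the complex `0 ← 𝒟*_0 ←D*_0 𝒟*_1 ← ⋯ ←D*_{N−1} 𝒟*_N ← 0` (2.6). The `i`th homology group of the dual
complex is `H*_i = ker D*_{N−i−1} / im D*_{N−i}` (2.3*). … For the dual complex we obviously have `𝓗̂*_i = 𝓗̂_{N−i}`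
(2.8b). … COROLLARY 2.6. The Hilbert complex `(𝒟, D)` is Fredholm if and only if the dual complex `(𝒟*, D*)` is.
In this case we have `𝓗̂*_i ≅ 𝓗̂_{N−i}` (2.23a). Moreover, if `D` and `D̃` denote the operators defined by (2.12) for
`(𝒟, D)` and `(𝒟*, D*)`, respectively, then we have … (2.23b) [and] `ind D̃ = ind(𝒟*, D*) = (−1)^N ind D =
(−1)^N ind(𝒟, D)` (2.23c). Proof. If `(𝒟, D)` is Fredholm then (2.3*) and the Hodge decomposition imply
`H*_i ≅ 𝓗̂_{N−i}`. Thus `(𝒟*, D*)` is Fredholm by (2.19), (2.21), and Theorem 2.4, 2. The converse follows from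
`(𝒟**, D**) = (𝒟, D)`. Now (2.23a) is a consequence of (2.8b). The remaining statements follow from
straightforward applications of the definitions. … In the weak Fredholm case, we define the analytic index of
`(𝒟, D)` as `înd(𝒟, D) := ∑_{i≥0} (−1)^i β̂_i = dim ker D − dim ker D*` (2.25)."

Here `N = 2`: the complex is `0 → E →T F →S G → 0` (`T`, `S` closed densely defined, `Im T ⊆ Ker S`), its dual is
`0 → G →S* F →T* E → 0` (again a Hilbert complex: `S*`, `T*` closed densely defined with `Im S* ⊆ Ker T*`,
§2), the cohomology of the dual is `H*₀ = Ker S*`, `H*₁ = Ker T* / Im S*`, `H*₂ = E / Im T*`, the harmonic spaces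
are `𝓗̂*₀ = Ker S* = 𝓗̂₂`, `𝓗̂*₁ = Ker T* ∩ Ker S** = Ker S ∩ Ker T* = 𝓗̂₁`, `𝓗̂*₂ = Ker T** = Ker T = 𝓗̂₀`, and the
rolled-up operator (2.12) of the dual is `D̃ = S* ⊕ T**` on `G ⊕ E` (so `(−1)^N = 1` in (2.23c)).

## What is proved (all over `𝕜 = ℝ` or `ℂ`)

* §1 **`finiteDimensional_cohomology_iff_harmonic`** — Thm 2.4 (1) ⇔ (2.17)–(2.19) without the rolled-up operator
  in the statement: `Ker T`, `Ker S / Im T`, `G / Im S` finite-dimensional ⇔ (`Ker T`, `𝔥`, `Ker S*`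
  finite-dimensional) ∧ (`Im T`, `Im S` closed).
* §2 the dual complex: `dual_isHilbertComplex` ((2.5)–(2.6): `S*`, `T*` closed densely defined, `Im S* ⊆ Ker T*`),
  **`harmonic_dual_eq`** ((2.8b): `Ker T* ∩ Ker S** = Ker S ∩ Ker T*`).
* §3 **Corollary 2.6**: **`finiteDimensional_cohomology_dual_iff`** — `Ker S*`, `Ker T* / Im S*`, `E / Im T*`
  finite-dimensional ⇔ `Ker T`, `Ker S / Im T`, `G / Im S` finite-dimensional.
* §4 (2.23a) with (2.18), the Betti numbers are reversed: `finrank_pmapKer_adjoint_eq_finrank_quotient_range`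
  (`p*₀ = p₂`), **`finrank_cohomology_dual_eq`** (`p*₁ = p₁`), `finrank_quotient_range_adjoint_eq_finrank_pmapKer`
  (`p*₂ = p₀`), and **`geometricIndex_dual_eq`** ((2.23c) with `N = 2`: `ind(𝒟*, D*) = ind(𝒟, D)`).
* §5 (2.23b)–(2.23c) for the rolled-up operators: `nonempty_pmapKer_rolledUp_dual_linearEquiv`
  (`Ker D̃ ≅ Ker S* × Ker T`), `orthogonal_range_rolledUp_dual_eq_harmonic` (`(Im D̃)^⊥ = 𝔥`),
  **`index_rolledUp_dual_eq`** (`dim Ker D̃ − dim (Im D̃)^⊥ = dim Ker D − dim (Im D)^⊥`).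

## References

* [BruningLesch1992] J. Brüning, M. Lesch, *Hilbert complexes*, J. Funct. Anal. 108 (1992) 88–132, §2 (2.3*),
  (2.5)–(2.6), (2.8b), (2.12), Thm 2.4, Cor 2.5 (2.17)–(2.18), Cor 2.6 (2.23a)–(2.23c), (2.25).
* [Kato1966] T. Kato, *Perturbation Theory for Linear Operators* (1966), IV §5.2 Thm 5.13 (closed range theorem,
  through `ClosedRangeTheoremHilbert.lean`).
* [Bei2014] F. Bei, arXiv:1401.2766, §1 Prop 1.4 ("`𝓗^i ≅ H^i ≅ H^{n−i}((D_j)*)`", through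
  `HilbertComplexHarmonicCohomology.lean`).
* [DemaillyAGBook] J.-P. Demailly, *Complex Analytic and Differential Geometry*, Ch. VIII §1 Thm 1.1 (`T** = T`,
  `Ker T* = (Im T)^⊥`, through `ClosedDenselyDefinedHilbertComplex.lean`).
* [Gilkey1995] P. B. Gilkey, *Invariance theory, the heat equation, and the Atiyah–Singer index theorem* (1995), §1.5
  p. 45 (the rolled-up two-term complex).
-/

noncomputable section

open scoped InnerProductSpace LinearPMap

namespace Literature.Analysis.InnerProduct

variable {𝕜 E F G : Type*} [RCLike 𝕜]
variable [NormedAddCommGroup E] [InnerProductSpace 𝕜 E] [CompleteSpace E]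
variable [NormedAddCommGroup F] [InnerProductSpace 𝕜 F] [CompleteSpace F]
variable [NormedAddCommGroup G] [InnerProductSpace 𝕜 G] [CompleteSpace G]

variable {T : E →ₗ.[𝕜] F} {S : F →ₗ.[𝕜] G}

/-! ### §1 Theorem 2.4 (1) ⇔ (2): finite cohomology iff finite harmonic spaces and closed ranges -/

/-- **Finite cohomology ⇔ finite-dimensional harmonic spaces and closed ranges** for the short complex
`0 → E →T F →S G → 0`: `Ker T`, `Ker S / Im T`, `G / Im S` are finite-dimensional iff `Ker T`, `𝔥 = Ker S ∩ Ker T*`,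
`Ker S*` are finite-dimensional and `Im T`, `Im S` are closed (Thm 2.4 (1) ⇔ (3) of row g33-#10 composed with its
description of "`D` Fredholm"; the rolled-up operator no longer appears). [cite: BruningLesch1992, §2 Thm 2.4 (proof
(2) ⇒ (3) ⇒ (1)), Cor 2.5 (2.17)–(2.19), (2.21)] -/
theorem finiteDimensional_cohomology_iff_harmonic (hdT : Dense (T.domain : Set E)) (hcT : T.IsClosed)
    (hdS : Dense (S.domain : Set F)) (hcS : S.IsClosed)
    (hST : LinearMap.range T.toFun ≤ (LinearMap.ker S.toFun).map S.domain.subtype) :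
    (FiniteDimensional 𝕜 ((LinearMap.ker T.toFun).map T.domain.subtype) ∧
      FiniteDimensional 𝕜 (↥((LinearMap.ker S.toFun).map S.domain.subtype) ⧸
        (LinearMap.range T.toFun).comap ((LinearMap.ker S.toFun).map S.domain.subtype).subtype) ∧
      FiniteDimensional 𝕜 (G ⧸ LinearMap.range S.toFun)) ↔
    ((FiniteDimensional 𝕜 ((LinearMap.ker T.toFun).map T.domain.subtype) ∧
        FiniteDimensional 𝕜 ↥((LinearMap.ker S.toFun).map S.domain.subtype ⊓
          (LinearMap.ker T†.toFun).map T†.domain.subtype) ∧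
        FiniteDimensional 𝕜 ((LinearMap.ker S†.toFun).map S†.domain.subtype)) ∧
      (IsClosed ((LinearMap.range T.toFun : Submodule 𝕜 F) : Set F) ∧
        IsClosed ((LinearMap.range S.toFun : Submodule 𝕜 G) : Set G))) := by
  obtain ⟨D, hdomD, hvalD⟩ := exists_rolledUp T S
  rw [finiteDimensional_cohomology_iff_rolledUp_fredholm hdT hcT hdS hcS hST hdomD hvalD,
    rolledUp_fredholm_iff hdT hdS hcS hST hdomD hvalD]

/-! ### §2 The dual complex `0 → G →S* F →T* E → 0` is a Hilbert complex with the same harmonic space -/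

/-- **(2.5)–(2.6): the dual complex is a Hilbert complex** — `S*` and `T*` are closed and densely defined and
`Im S* ⊆ Ker T*` ("`D*_{i−1}(𝒟*_i) ⊂ 𝒟*_{i−1}` (2.5a) and `D*_{i−1} ∘ D*_i = 0` (2.5b)"). [cite: BruningLesch1992, §2
(2.5a)–(2.6); DemaillyAGBook, Ch. VIII §1 Thm 1.1 ("its adjoint `T*` is also closed and densely defined")] -/
theorem dual_isHilbertComplex (hdT : Dense (T.domain : Set E)) (hcT : T.IsClosed)
    (hdS : Dense (S.domain : Set F)) (hcS : S.IsClosed)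
    (hST : LinearMap.range T.toFun ≤ (LinearMap.ker S.toFun).map S.domain.subtype) :
    (Dense (S†.domain : Set G) ∧ S†.IsClosed) ∧ (Dense (T†.domain : Set F) ∧ T†.IsClosed) ∧
      LinearMap.range S†.toFun ≤ (LinearMap.ker T†.toFun).map T†.domain.subtype :=
  ⟨⟨dense_adjoint_domain_of_isClosed hdS hcS, LinearPMap.adjoint_isClosed hdS⟩,
    ⟨dense_adjoint_domain_of_isClosed hdT hcT, LinearPMap.adjoint_isClosed hdT⟩,
    range_adjoint_le_pmapKer_adjoint hdS hST⟩

/-- **(2.8b) `𝓗̂*₁ = 𝓗̂₁`: the harmonic space of the dual complex in the middle degree, `Ker T* ∩ Ker S**`, is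
`𝔥 = Ker S ∩ Ker T*`** (`S** = S`). [cite: BruningLesch1992, §2 (2.8b) ("`𝓗̂*_i = 𝓗̂_{N−i}`"); DemaillyAGBook,
Ch. VIII §1 Thm 1.1 (`(T*)* = T`)] -/
theorem harmonic_dual_eq (hdS : Dense (S.domain : Set F)) (hcS : S.IsClosed) :
    (LinearMap.ker T†.toFun).map T†.domain.subtype ⊓ (LinearMap.ker S††.toFun).map S††.domain.subtype =
      (LinearMap.ker S.toFun).map S.domain.subtype ⊓ (LinearMap.ker T†.toFun).map T†.domain.subtype := by
  rw [adjoint_adjoint_of_isClosed hdS hcS, inf_comm]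

/-! ### §3 Corollary 2.6: the dual complex is Fredholm iff the complex is -/

/-- **Brüning–Lesch, Corollary 2.6, for a short complex: the dual complex `0 → G →S* F →T* E → 0` is Fredholm iff
`0 → E →T F →S G → 0` is** — `Ker S*`, `Ker T* / Im S*`, `E / Im T*` are finite-dimensional iff `Ker T`,
`Ker S / Im T`, `G / Im S` are (both sides are "`Ker T`, `𝔥`, `Ker S*` finite-dimensional and `Im T`, `Im S` closed",
through `T** = T`, `𝓗̂* = 𝓗̂` and the closed range theorem `Im T* closed ⇔ Im T closed`). [cite: BruningLesch1992,
§2 Cor 2.6 ("The Hilbert complex `(𝒟, D)` is Fredholm if and only if the dual complex `(𝒟*, D*)` is"), with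
(2.19), (2.21) and `(𝒟**, D**) = (𝒟, D)`; Kato1966, IV §5.2 Thm 5.13] -/
theorem finiteDimensional_cohomology_dual_iff (hdT : Dense (T.domain : Set E)) (hcT : T.IsClosed)
    (hdS : Dense (S.domain : Set F)) (hcS : S.IsClosed)
    (hST : LinearMap.range T.toFun ≤ (LinearMap.ker S.toFun).map S.domain.subtype) :
    (FiniteDimensional 𝕜 ((LinearMap.ker S†.toFun).map S†.domain.subtype) ∧
      FiniteDimensional 𝕜 (↥((LinearMap.ker T†.toFun).map T†.domain.subtype) ⧸
        (LinearMap.range S†.toFun).comap ((LinearMap.ker T†.toFun).map T†.domain.subtype).subtype) ∧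
      FiniteDimensional 𝕜 (E ⧸ LinearMap.range T†.toFun)) ↔
    (FiniteDimensional 𝕜 ((LinearMap.ker T.toFun).map T.domain.subtype) ∧
      FiniteDimensional 𝕜 (↥((LinearMap.ker S.toFun).map S.domain.subtype) ⧸
        (LinearMap.range T.toFun).comap ((LinearMap.ker S.toFun).map S.domain.subtype).subtype) ∧
      FiniteDimensional 𝕜 (G ⧸ LinearMap.range S.toFun)) := by
  have hdT' : Dense (S†.domain : Set G) := dense_adjoint_domain_of_isClosed hdS hcS
  have hdS' : Dense (T†.domain : Set F) := dense_adjoint_domain_of_isClosed hdT hcT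
  have hH : (LinearMap.ker T†.toFun).map T†.domain.subtype ⊓ (LinearMap.ker S.toFun).map S.domain.subtype =
      (LinearMap.ker S.toFun).map S.domain.subtype ⊓ (LinearMap.ker T†.toFun).map T†.domain.subtype := inf_comm _ _
  rw [finiteDimensional_cohomology_iff_harmonic (T := S†) (S := T†) hdT' (LinearPMap.adjoint_isClosed hdS) hdS'
      (LinearPMap.adjoint_isClosed hdT) (range_adjoint_le_pmapKer_adjoint hdS hST),
    finiteDimensional_cohomology_iff_harmonic hdT hcT hdS hcS hST, adjoint_adjoint_of_isClosed hdS hcS,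
    adjoint_adjoint_of_isClosed hdT hcT, hH, ← isClosed_range_iff_isClosed_range_adjoint hdS hcS,
    ← isClosed_range_iff_isClosed_range_adjoint hdT hcT]
  constructor
  · rintro ⟨⟨a, b, c⟩, d, e⟩
    exact ⟨⟨c, b, a⟩, e, d⟩
  · rintro ⟨⟨a, b, c⟩, d, e⟩
    exact ⟨⟨c, b, a⟩, e, d⟩

/-! ### §4 (2.23a) with (2.18): the Betti numbers of the dual complex are those of the complex, reversed -/

omit [CompleteSpace E] in
/-- **`p*₀ = p₂`: `dim Ker S* = dim (G ⧸ Im S)`** when `Im S` is closed (`Ker S* = (Im S)^⊥`). [cite: BruningLesch1992,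
§2 Cor 2.6 (2.23a) with Cor 2.5 (2.18) ("`𝓗̂_i ≅ H_i`"), (2.21)] -/
theorem finrank_pmapKer_adjoint_eq_finrank_quotient_range (hdS : Dense (S.domain : Set F))
    (hRS : IsClosed ((LinearMap.range S.toFun : Submodule 𝕜 G) : Set G)) :
    Module.finrank 𝕜 ((LinearMap.ker S†.toFun).map S†.domain.subtype) =
      Module.finrank 𝕜 (G ⧸ LinearMap.range S.toFun) := by
  obtain ⟨e⟩ := nonempty_pmapKer_adjoint_linearEquiv_quotient_range hdS hRS
  exact e.finrank_eq

/-- **`p*₁ = p₁`: `dim (Ker T* / Im S*) = dim (Ker S / Im T)`** when `Im T`, `Im S` are closed (both are `≅ 𝔥`: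
"`H*_i ≅ 𝓗̂_{N−i}`" and "`𝓗̂_i ≅ H_i`"). [cite: BruningLesch1992, §2 Cor 2.6 (proof: "(2.3*) and the Hodge decomposition
imply `H*_i ≅ 𝓗̂_{N−i}`"), Cor 2.5 (2.18); Bei2014, §1 Prop 1.4] -/
theorem finrank_cohomology_dual_eq (hdT : Dense (T.domain : Set E)) (hdS : Dense (S.domain : Set F))
    (hcS : S.IsClosed) (hST : LinearMap.range T.toFun ≤ (LinearMap.ker S.toFun).map S.domain.subtype)
    (hRT : IsClosed ((LinearMap.range T.toFun : Submodule 𝕜 F) : Set F))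
    (hRS : IsClosed ((LinearMap.range S.toFun : Submodule 𝕜 G) : Set G)) :
    Module.finrank 𝕜 (↥((LinearMap.ker T†.toFun).map T†.domain.subtype) ⧸
        (LinearMap.range S†.toFun).comap ((LinearMap.ker T†.toFun).map T†.domain.subtype).subtype) =
      Module.finrank 𝕜 (↥((LinearMap.ker S.toFun).map S.domain.subtype) ⧸
        (LinearMap.range T.toFun).comap ((LinearMap.ker S.toFun).map S.domain.subtype).subtype) := by
  obtain ⟨e₁⟩ := nonempty_linearEquiv_harmonic_quotient_range_adjoint hdT hdS hcS hST hRS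
  obtain ⟨e₂⟩ := nonempty_linearEquiv_harmonic_quotient_range hdT hcS hST hRT
  rw [← e₁.finrank_eq, e₂.finrank_eq]

omit [CompleteSpace G] in
/-- **`p*₂ = p₀`: `dim (E ⧸ Im T*) = dim Ker T`** when `Im T` is closed (`Im T*` is then closed and
`(Im T*)^⊥ = Ker T** = Ker T`). [cite: BruningLesch1992, §2 Cor 2.6 (2.23a) with (2.18)–(2.19) and `(𝒟**, D**) =
(𝒟, D)`; Kato1966, IV §5.2 Thm 5.13] -/
theorem finrank_quotient_range_adjoint_eq_finrank_pmapKer (hdT : Dense (T.domain : Set E)) (hcT : T.IsClosed)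
    (hRT : IsClosed ((LinearMap.range T.toFun : Submodule 𝕜 F) : Set F)) :
    Module.finrank 𝕜 (E ⧸ LinearMap.range T†.toFun) =
      Module.finrank 𝕜 ((LinearMap.ker T.toFun).map T.domain.subtype) := by
  obtain ⟨e⟩ := nonempty_pmapKer_adjoint_linearEquiv_quotient_range (S := T†)
    (dense_adjoint_domain_of_isClosed hdT hcT) ((isClosed_range_iff_isClosed_range_adjoint hdT hcT).1 hRT)
  have h := e.finrank_eq
  rw [adjoint_adjoint_of_isClosed hdT hcT] at h
  exact h.symm

/-- **(2.23c) with `N = 2`: the geometric index of the dual complex is that of the complex** —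
`dim Ker S* − dim (Ker T* / Im S*) + dim (E / Im T*) = dim Ker T − dim (Ker S / Im T) + dim (G / Im S)` for a
Fredholm complex (the Betti numbers are reversed: `p*_i = p_{2−i}`). [cite: BruningLesch1992, §2 (2.4b), Cor 2.6
(2.23a), (2.23c) ("`ind(𝒟*, D*) = (−1)^N ind(𝒟, D)`")] -/
theorem geometricIndex_dual_eq (hdT : Dense (T.domain : Set E)) (hcT : T.IsClosed)
    (hdS : Dense (S.domain : Set F)) (hcS : S.IsClosed)
    (hST : LinearMap.range T.toFun ≤ (LinearMap.ker S.toFun).map S.domain.subtype)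
    [FiniteDimensional 𝕜 (↥((LinearMap.ker S.toFun).map S.domain.subtype) ⧸
      (LinearMap.range T.toFun).comap ((LinearMap.ker S.toFun).map S.domain.subtype).subtype)]
    [FiniteDimensional 𝕜 (G ⧸ LinearMap.range S.toFun)] :
    (Module.finrank 𝕜 ((LinearMap.ker S†.toFun).map S†.domain.subtype) : ℤ) -
        Module.finrank 𝕜 (↥((LinearMap.ker T†.toFun).map T†.domain.subtype) ⧸
          (LinearMap.range S†.toFun).comap ((LinearMap.ker T†.toFun).map T†.domain.subtype).subtype) +
        Module.finrank 𝕜 (E ⧸ LinearMap.range T†.toFun) =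
      (Module.finrank 𝕜 ((LinearMap.ker T.toFun).map T.domain.subtype) : ℤ) -
        Module.finrank 𝕜 (↥((LinearMap.ker S.toFun).map S.domain.subtype) ⧸
          (LinearMap.range T.toFun).comap ((LinearMap.ker S.toFun).map S.domain.subtype).subtype) +
        Module.finrank 𝕜 (G ⧸ LinearMap.range S.toFun) := by
  have hRT : IsClosed ((LinearMap.range T.toFun : Submodule 𝕜 F) : Set F) :=
    isClosed_range_of_finiteDimensional_cohomology hcT hcS hST
  have hRS : IsClosed ((LinearMap.range S.toFun : Submodule 𝕜 G) : Set G) :=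
    isClosed_range_of_finiteDimensional_quotient hcS
  rw [finrank_pmapKer_adjoint_eq_finrank_quotient_range hdS hRS, finrank_cohomology_dual_eq hdT hdS hcS hST hRT hRS,
    finrank_quotient_range_adjoint_eq_finrank_pmapKer hdT hcT hRT]
  ring

/-! ### §5 (2.23b)–(2.23c): the rolled-up operator `D̃ = S* ⊕ T**` of the dual complex has the index of `D` -/

section RolledUp

variable {D : WithLp 2 (E × G) →ₗ.[𝕜] F} {D' : WithLp 2 (G × E) →ₗ.[𝕜] F}

omit [CompleteSpace G] in
/-- **`Ker D̃ ≅ Ker S* × Ker T`** for the rolled-up operator `D̃(z ⊕ x) = S*z + T**x` of the dual complex ((2.19) for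
the dual, with `Ker T** = Ker T`). [cite: BruningLesch1992, §2 (2.19), Cor 2.6 (2.23b); Gilkey1995, §1.5 p. 45] -/
theorem nonempty_pmapKer_rolledUp_dual_linearEquiv (hdT : Dense (T.domain : Set E)) (hcT : T.IsClosed)
    (hdS : Dense (S.domain : Set F))
    (hST : LinearMap.range T.toFun ≤ (LinearMap.ker S.toFun).map S.domain.subtype)
    (hdomD' : ∀ v : WithLp 2 (G × E), v ∈ D'.domain ↔ v.fst ∈ S†.domain ∧ v.snd ∈ T††.domain)
    (hvalD' : ∀ (v : D'.domain) (h1 : (v : WithLp 2 (G × E)).fst ∈ S†.domain)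
      (h2 : (v : WithLp 2 (G × E)).snd ∈ T††.domain),
      D' v = S† ⟨(v : WithLp 2 (G × E)).fst, h1⟩ + T†† ⟨(v : WithLp 2 (G × E)).snd, h2⟩) :
    Nonempty (((LinearMap.ker D'.toFun).map D'.domain.subtype) ≃ₗ[𝕜]
      (((LinearMap.ker S†.toFun).map S†.domain.subtype) × ((LinearMap.ker T.toFun).map T.domain.subtype))) := by
  have h := nonempty_pmapKer_rolledUp_linearEquiv (T := S†) (S := T†) (D := D')
    (dense_adjoint_domain_of_isClosed hdT hcT) (range_adjoint_le_pmapKer_adjoint hdS hST) hdomD' hvalD'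
  rw [adjoint_adjoint_of_isClosed hdT hcT] at h
  exact h

/-- **`(Im D̃)^⊥ = 𝔥`**: the cokernel of the rolled-up operator of the dual complex is again the harmonic space
`Ker S ∩ Ker T*` ((2.21) for the dual with (2.8b)). [cite: BruningLesch1992, §2 (2.8b), (2.21), Cor 2.6 (2.23a)] -/
theorem orthogonal_range_rolledUp_dual_eq_harmonic (hdT : Dense (T.domain : Set E)) (hcT : T.IsClosed)
    (hdS : Dense (S.domain : Set F)) (hcS : S.IsClosed)
    (hdomD' : ∀ v : WithLp 2 (G × E), v ∈ D'.domain ↔ v.fst ∈ S†.domain ∧ v.snd ∈ T††.domain)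
    (hvalD' : ∀ (v : D'.domain) (h1 : (v : WithLp 2 (G × E)).fst ∈ S†.domain)
      (h2 : (v : WithLp 2 (G × E)).snd ∈ T††.domain),
      D' v = S† ⟨(v : WithLp 2 (G × E)).fst, h1⟩ + T†† ⟨(v : WithLp 2 (G × E)).snd, h2⟩) :
    (LinearMap.range D'.toFun)ᗮ =
      (LinearMap.ker S.toFun).map S.domain.subtype ⊓ (LinearMap.ker T†.toFun).map T†.domain.subtype := by
  rw [orthogonal_range_rolledUp_eq_harmonic (T := S†) (S := T†) (D := D') (dense_adjoint_domain_of_isClosed hdS hcS)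
    (dense_adjoint_domain_of_isClosed hdT hcT) (LinearPMap.adjoint_isClosed hdT) hdomD' hvalD',
    harmonic_dual_eq hdS hcS]

/-- **(2.23b)–(2.23c) for `N = 2`: `ind D̃ = ind D`** — the rolled-up operator `D̃ = S* ⊕ T**` of the dual complex
and the rolled-up operator `D = T ⊕ S*` of the complex have the same index
`dim Ker − dim (Im)^⊥ = dim Ker T − dim 𝔥 + dim Ker S*` (weak Fredholm case: `Ker T`, `Ker S*` finite-dimensional).
[cite: BruningLesch1992, §2 Cor 2.6 (2.23b)–(2.23c) ("`ind D̃ = ind(𝒟*, D*) = (−1)^N ind D`"), (2.25); Gilkey1995,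
§1.5 p. 45] -/
theorem index_rolledUp_dual_eq (hdT : Dense (T.domain : Set E)) (hcT : T.IsClosed)
    (hdS : Dense (S.domain : Set F)) (hcS : S.IsClosed)
    (hST : LinearMap.range T.toFun ≤ (LinearMap.ker S.toFun).map S.domain.subtype)
    (hdomD : ∀ v : WithLp 2 (E × G), v ∈ D.domain ↔ v.fst ∈ T.domain ∧ v.snd ∈ S†.domain)
    (hvalD : ∀ (v : D.domain) (h1 : (v : WithLp 2 (E × G)).fst ∈ T.domain)
      (h2 : (v : WithLp 2 (E × G)).snd ∈ S†.domain),
      D v = T ⟨(v : WithLp 2 (E × G)).fst, h1⟩ + S† ⟨(v : WithLp 2 (E × G)).snd, h2⟩)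
    (hdomD' : ∀ v : WithLp 2 (G × E), v ∈ D'.domain ↔ v.fst ∈ S†.domain ∧ v.snd ∈ T††.domain)
    (hvalD' : ∀ (v : D'.domain) (h1 : (v : WithLp 2 (G × E)).fst ∈ S†.domain)
      (h2 : (v : WithLp 2 (G × E)).snd ∈ T††.domain),
      D' v = S† ⟨(v : WithLp 2 (G × E)).fst, h1⟩ + T†† ⟨(v : WithLp 2 (G × E)).snd, h2⟩)
    [FiniteDimensional 𝕜 ((LinearMap.ker T.toFun).map T.domain.subtype)]
    [FiniteDimensional 𝕜 ((LinearMap.ker S†.toFun).map S†.domain.subtype)] :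
    (Module.finrank 𝕜 ((LinearMap.ker D'.toFun).map D'.domain.subtype) : ℤ) -
        Module.finrank 𝕜 (LinearMap.range D'.toFun)ᗮ =
      (Module.finrank 𝕜 ((LinearMap.ker D.toFun).map D.domain.subtype) : ℤ) -
        Module.finrank 𝕜 (LinearMap.range D.toFun)ᗮ := by
  haveI : FiniteDimensional 𝕜 ((LinearMap.ker T††.toFun).map T††.domain.subtype) := by
    rw [adjoint_adjoint_of_isClosed hdT hcT]
    infer_instance
  have h' := finrank_pmapKer_rolledUp_sub_finrank_orthogonal_range (T := S†) (S := T†) (D := D')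
    (dense_adjoint_domain_of_isClosed hdS hcS) (dense_adjoint_domain_of_isClosed hdT hcT)
    (LinearPMap.adjoint_isClosed hdT) (range_adjoint_le_pmapKer_adjoint hdS hST) hdomD' hvalD'
  rw [harmonic_dual_eq hdS hcS, adjoint_adjoint_of_isClosed hdT hcT] at h'
  rw [h', finrank_pmapKer_rolledUp_sub_finrank_orthogonal_range hdT hdS hcS hST hdomD hvalD]
  ring

end RolledUp

end Literature.Analysis.InnerProduct
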